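import Summits.BirchSwinnertonDyer.Rank1Residual.X12.O11.RamifiedStrictDescentAtThreeDefect
import Summits.BirchSwinnertonDyer.Rank1Residual.X12.O11.RamifiedStrictDescentAtThreeDischarge
import HarnessLib

/-!
# O11 at `p = 3`, companion VI — REGIME V of route `PrintCFram` (item stmt-BirchSwinnertonDyer-20700):
# the three halves RE-TYPED WITH THE CONTROL DEFECT `d(T₀)` displayed — (R-tors)₃ᵛ, (R-ctrl)₃ᵛ♯,
# (R-EU)₃ᵛ — (R-ctrl)₃ᵛ♯ PROVED outright, (R-tors)₃ᵛ PROVED from GZK, and the consumer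
# `⟹ BSD(W, 3)` on regimes N ∪ V from the ONE residual (R-EU)₃ᵛ
# (cell `bsd-print-cfram`, D-0131 (2), typer `ty2` gen 2; PLAN v3 §2 ty2 (γ′) «consumer: defect control +
# δ_V-corrected (R-EU)₃ᵛ ⟹ SplitPlaceTorsionBSDThree on the frame»; NOTHING about BSD asserted)

HONEST FRAMING (cell `bsd-print-cfram`, HOME `run/shared/lean/pub/bsd-print-cfram/`): no named fact, no
axiom, no `sorry`; ONE real definition (the displayed defect `controlDefectAtThree`, a natural number)
and THREE `@[conjecture]` inputs (summit-side obligations, as in gen 1's `RamifiedStrictDescentAtThree`),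
two of which are DISCHARGED in the sequel file; regime V and the leaf stay OPEN; beyond-print theorem: NO.

SETTING. A `3`-frame `(K, 𝔭, W', C)` of `W` (`K = ℚ(√−3)`), `r_an(W) = 1`, anticyclotomic `κ` with
topological generator `γ`, the `ℚ₃`-binders (A𝔭)₃ «`W(ℚ₃)[3] = 0`, `W'(ℚ₃)[3] = 0`», and — instead of
gen 1's (Av)₃ at EVERY degree-one `v ∤ 3` — a finite set `T₀` of places `v ∤ 3` OFF which (Av)₃ holds
(on regime V take `T₀ ⊇ S_V`, the degree-one bad places with `3 ∣ c_v(W_K)`; `T₀ = Σ(N⁺)` always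
works, §5). The control defect of companion V,
`d(T₀) := #im(loc_{{𝔭} ∪ T₀} |_A)`, `A = res⁻¹(Sel_𝔭(K_∞, W[3^∞]))` (`controlDefectAtThree`), enters
(R-ctrl)₃ᵛ♯ and (R-EU)₃ᵛ on the same side, so the consumer's arithmetic is gen 1's verbatim.

* §1 `controlDefectAtThree W K 𝔭 κ T₀ : ℕ` (def) — the displayed defect; `= 3^{#S_V − t}` in lit
  DOSSIER v6 §32's notation (`t` = number of Mordell–Weil generators of `W`, `W'` off the identity
  component at the V-places; `t = 1` on the 20 + 35 certified V frames, kit j284290/j284760, REF S24);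
  `d ≤ 3^{Σ_{v ∈ T₀} ord₃ c_v(W_K)}` (companion V); `d ∣`-free, duality-free.
* §2 the three inputs, `@[conjecture]`, nothing asserted: `RamifiedCMStrictTorsionAtThreeV W`
  ((R-tors)₃ᵛ), `RamifiedCMDefectControlAtThree W` ((R-ctrl)₃ᵛ♯:
  `n₀ + log₃ #X[T] = log₃ #Sel_str(W)[3^∞] + log₃ #Sel_str(W')[3^∞] + log₃ d(T₀)`),
  `RamifiedCMEllipticUnitIndexAtThreeV W` ((R-EU)₃ᵛ:
  `n₀ + log₃ #X[T] = n + n' + ord₃ #Ш_an(W) + ord₃ #Ш_an(W') + log₃ d(T₀)` — Perrin-Riou's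
  leading-term law for the CM zeta element at the ramified prime `3` CORRECTED BY THE DISPLAYED DEFECT;
  NOT in print; the V line's ONE residual).
* §3 `bsdp_three_of_halvesV` — the three inputs + frame data + four named facts ⟹ `BSDp W 3`
  (gen 1's `bsdp_three_of_halves`, the two `log₃ d` cancelling).
* The DISCHARGES ((R-ctrl)₃ᵛ♯ outright, (R-tors)₃ᵛ ⟸ GZK) and the consumer from (R-EU)₃ᵛ alone,
  with `T₀ = Σ(N⁺)` admissible at every frame, are the sequel
  `RamifiedStrictDescentAtThreeRegimeVDischarge.lean` (≤ 400-line rule).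

References: [GreenbergLNM1716] §3 Lemmas 3.1–3.3, p. 90, §4 Lemma 4.2 (p. 102), Prop. 4.13;
[Castella2018] Def. 2.2, Thm. 2.3 (shape); [PerrinRiou1993AIF] §3.3.4–3.3.5; [BurungaleKobayashiNakamuraOta2026]
§1.4, Thm. 7.2 (shape, `p ≥ 5`); [Miller2011LMS] Def. 1.1; [Cassels1965ArithmeticVIII]; [GrossZagier1986]
Thm. I.(7.3); tree: companions I–V (`RamifiedStrictDescentAtThree{,Local,Discharge,Leaf,Tamagawa,Defect}`),
X11b `AnticyclotomicControlNPlus`; HOME/DOSSIER.md §32, §35; PLAN v3 §1c(V), §2 ty2.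
-/

noncomputable section

open scoped Classical

open WeierstrassCurve NumberField IsDedekindDomain Field PowerSeries
  Literature.NumberTheory.EllipticCurves
  Literature.NumberTheory.EllipticCurves.GreenbergSelmer
  Literature.NumberTheory.EllipticCurves.Rank1Residual
  Literature.NumberTheory.GaloisRepresentations
  Summit.BirchSwinnertonDyer.Rank1Residual
  Summit.BirchSwinnertonDyer.Rank1Residual.Additive
  Summit.BirchSwinnertonDyer.Rank1Residual.X11b
  Summit.BirchSwinnertonDyer.Rank1Residual.X11b.AcSelmer
  Summit.BirchSwinnertonDyer.BirchSwinnertonDyer.Theorems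

namespace Summit.BirchSwinnertonDyer.Rank1Residual.X12.O11

/-! ## §1 The displayed control defect `d(T₀)` -/

section Defect

variable (W : WeierstrassCurve ℚ) (K : Type) [Field K] [NumberField K]
  (𝔭 : HeightOneSpectrum (𝓞 K)) (κ : ZpExtension K 3) (T₀ : Finset (HeightOneSpectrum (𝓞 K)))

/-- **The control defect `d(T₀)` at `3`** (a natural number): the order of the image of Greenberg's
`A = res⁻¹(Sel_𝔭(K_∞, W[3^∞]))` (`X11b.AcSelmer.selmerAcPreimage`, `Σ = ∅`) under the localisation
`loc_{{𝔭} ∪ T₀} : H¹(K, W[3^∞]) → ⊕_{v ∈ {𝔭} ∪ T₀} H¹(K_v, W[3^∞])` (`X11b.AcSelmer.locAtFinset`). By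
companion V (`natCard_invariants_eq_mul_defect_of_isFrameThree`): at a `3`-frame with (A𝔭)₃ and
(Av)₃ off `T₀`, `#Sel^γ = #Sel_𝔭(K, W[3^∞]) · d(T₀)`, the image lies in `⊕_{v ∈ T₀} ker r_v` (its
`𝔭`-component vanishes) and `d(T₀) ≤ 3^{Σ_{v ∈ T₀} ord₃ c_v(W_K)}`; `d(∅) = 1` (regime N). In lit
DOSSIER v6 §32's notation `d(S_V) = 3^{#S_V − t}`, `3^t` the Poitou–Tate cokernel (Milne ADT I.4.10 /
Greenberg Prop. 4.13: dual to the image of `E(K) ⊗ ℤ₃` in `⊕_{S_V} Φ_v`) — DISPLAYED here as a number,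
never evaluated or bound by a hypothesis (`Nat.card` of an infinite group would read `0`).
[cite: GreenbergLNM1716, §3 p. 90 and §4 Prop. 4.13 (the global-to-local term)]
[cite: MilneADT2006, Thm. I.4.10 (Poitou–Tate; the cokernel is dual to a compact Selmer group)] -/
def controlDefectAtThree : ℕ :=
  Nat.card ((locAtFinset (W.baseChange K) 3 (insert 𝔭 T₀)).comp
    (selmerAcPreimage (W.baseChange K) 3 κ 𝔭 ∅).subtype).range

/-- Unfolding `controlDefectAtThree`. [folklore] -/
theorem controlDefectAtThree_def :
    controlDefectAtThree W K 𝔭 κ T₀ =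
      Nat.card ((locAtFinset (W.baseChange K) 3 (insert 𝔭 T₀)).comp
        (selmerAcPreimage (W.baseChange K) 3 κ 𝔭 ∅).subtype).range :=
  rfl

end Defect

variable (W : WeierstrassCurve ℚ) [W.IsElliptic] [W.IsGloballyMinimal]

/-! ## §2 The three inputs on regimes N ∪ V (all `@[conjecture]`; nothing asserted)

Binders (all three): a `3`-frame `(K, 𝔭, W', C)` of `W`, `r_an(W) = 1`, anticyclotomic `κ` with
topological generator `γ`, the `ℚ₃`-binders (A𝔭)₃, a finite set `T₀` of places `v ∤ 3` of `K` and
(Av)₃ OFF `T₀` («at every degree-one `v ∤ 3`, `v ∉ T₀`: `W_K` good at `v` or `W(K_v)[3] = 0»); for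
(R-ctrl)₃ᵛ♯ / (R-EU)₃ᵛ also the generator data `P, n, P', n'`. -/

/-- **(R-tors)₃ᵛ TYPED (nothing asserted)**: at a `3`-framed pair of analytic rank one, for
anticyclotomic `κ` with generator `γ`, under (A𝔭)₃ and (Av)₃ off a finite `T₀` of places `v ∤ 3`:
`X = XAc (W_K) 3 κ 𝔭 ∅ γ` has the shape `ord₃ f(0) = n₀` for some `n₀` and `X[T]` is finite. Gen 1's
(R-tors)₃ with the away binder weakened to «off `T₀`». In analytic rank one it FOLLOWS FROM GZK
(sequel, `ramifiedCMStrictTorsionAtThreeV_of_GZK`); typed as an input; nothing asserted.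
[cite: BurungaleKobayashiNakamuraOta2026, Prop. 3.7 (2) (arXiv:2608.06879 pp. 19–20; `p ≥ 3`; claim; preprint; shape only)]
[cite: Castella2018, Def. 2.2 and Thm. 2.3 (arXiv:1704.06608 p. 5) (shape only)] -/
@[conjecture] def RamifiedCMStrictTorsionAtThreeV : Prop :=
  ∀ (K : Type) [Field K] [NumberField K] (𝔭 : HeightOneSpectrum (𝓞 K))
    (W' : WeierstrassCurve ℚ) [W'.IsElliptic] [W'.IsGloballyMinimal] (C : VariableChange ℚ),
    IsFrameThree W K 𝔭 W' C → W.analyticRank = 1 →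
    ∀ (κ : ZpExtension K 3), κ.IsAnticyclotomic →
      ∀ (γ : absoluteGaloisGroup K) [Fact (κ.IsTopGenerator γ)],
        (∀ Q : (W.baseChange ℚ_[3]).toAffine.Point, (3 : ℕ) • Q = 0 → Q = 0) →
        (∀ Q : (W'.baseChange ℚ_[3]).toAffine.Point, (3 : ℕ) • Q = 0 → Q = 0) →
        ∀ (T₀ : Finset (HeightOneSpectrum (𝓞 K))), (∀ v ∈ T₀, ((3 : ℕ) : 𝓞 K) ∉ v.asIdeal) →
        (∀ v : HeightOneSpectrum (𝓞 K), v ∉ T₀ → ((3 : ℕ) : 𝓞 K) ∉ v.asIdeal →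
          v.asIdeal.ramificationIdx (𝓞 ℚ) = 1 → v.asIdeal.inertiaDeg (𝓞 ℚ) = 1 →
          (W.baseChange K).HasGoodReductionAt v ∨
            ∀ R : ((W.baseChange K).baseChange (v.adicCompletion K)).toAffine.Point,
              (3 : ℕ) • R = 0 → R = 0) →
        (∃ n₀ : ℕ, AcSelmer.XAc.HasCharValuationAt (W.baseChange K) 3 κ 𝔭 ∅ γ n₀) ∧
          Finite {x : AcSelmer.XAc (W.baseChange K) 3 κ 𝔭 ∅ γ //
            (PowerSeries.X : IwasawaAlgebra 3) • x = 0}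

/-- **(R-ctrl)₃ᵛ♯ TYPED (nothing asserted): DEFECT-CORRECTED bottom-layer control at the ramified prime
`3`, regimes N ∪ V.** Same binders plus generators `P ∈ W(ℚ)`, `P' ∈ W'(ℚ)` modulo torsion with exact
`3`-divisibility levels `n`, `n'`: whenever `X` has the shape `ord₃ f(0) = n₀` with `X[T]` finite,
  `n₀ + log₃ #X[T] = log₃ #Sel_str(W/ℚ)[3^∞] + log₃ #Sel_str(W'/ℚ)[3^∞] + log₃ d(T₀)`,
`d(T₀) = controlDefectAtThree W K 𝔭 κ T₀`. PROVED OUTRIGHT in the sequel (`ramifiedCMDefectControlAtThree_holds`);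
typed as an input so that the consumer's shape is gen 1's. [cite: GreenbergLNM1716, §3 Lemmas 3.1–3.3, p. 90, §4 Lemma 4.2 (p. 102) and Prop. 4.13]
[cite: Castella2018, Def. 2.2 and Thm. 2.3 (arXiv:1704.06608 p. 5) (shape only)] -/
@[conjecture] def RamifiedCMDefectControlAtThree : Prop :=
  ∀ (K : Type) [Field K] [NumberField K] (𝔭 : HeightOneSpectrum (𝓞 K))
    (W' : WeierstrassCurve ℚ) [W'.IsElliptic] [W'.IsGloballyMinimal] (C : VariableChange ℚ),
    IsFrameThree W K 𝔭 W' C → W.analyticRank = 1 →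
    ∀ (κ : ZpExtension K 3), κ.IsAnticyclotomic →
      ∀ (γ : absoluteGaloisGroup K) [Fact (κ.IsTopGenerator γ)]
        (P : W.toAffine.Point) (n : ℕ) (P' : W'.toAffine.Point) (n' : ℕ),
        ¬ IsOfFinAddOrder P →
        (∀ R : W.toAffine.Point, ∃ (k : ℤ) (T : W.toAffine.Point), IsOfFinAddOrder T ∧ R = k • P + T) →
        (∀ Q : (W.baseChange ℚ_[3]).toAffine.Point, (3 : ℕ) • Q = 0 → Q = 0) →
        (∃ Q : (W.baseChange ℚ_[3]).toAffine.Point, (3 : ℕ) ^ n • Q = W.toPadicPoint 3 P) →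
        (∀ Q : (W.baseChange ℚ_[3]).toAffine.Point, (3 : ℕ) ^ (n + 1) • Q ≠ W.toPadicPoint 3 P) →
        ¬ IsOfFinAddOrder P' →
        (∀ R : W'.toAffine.Point, ∃ (k : ℤ) (T : W'.toAffine.Point),
          IsOfFinAddOrder T ∧ R = k • P' + T) →
        (∀ Q : (W'.baseChange ℚ_[3]).toAffine.Point, (3 : ℕ) • Q = 0 → Q = 0) →
        (∃ Q : (W'.baseChange ℚ_[3]).toAffine.Point, (3 : ℕ) ^ n' • Q = W'.toPadicPoint 3 P') →
        (∀ Q : (W'.baseChange ℚ_[3]).toAffine.Point, (3 : ℕ) ^ (n' + 1) • Q ≠ W'.toPadicPoint 3 P') →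
        ∀ (T₀ : Finset (HeightOneSpectrum (𝓞 K))), (∀ v ∈ T₀, ((3 : ℕ) : 𝓞 K) ∉ v.asIdeal) →
        (∀ v : HeightOneSpectrum (𝓞 K), v ∉ T₀ → ((3 : ℕ) : 𝓞 K) ∉ v.asIdeal →
          v.asIdeal.ramificationIdx (𝓞 ℚ) = 1 → v.asIdeal.inertiaDeg (𝓞 ℚ) = 1 →
          (W.baseChange K).HasGoodReductionAt v ∨
            ∀ R : ((W.baseChange K).baseChange (v.adicCompletion K)).toAffine.Point,
              (3 : ℕ) • R = 0 → R = 0) →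
        ∀ (n₀ : ℕ), AcSelmer.XAc.HasCharValuationAt (W.baseChange K) 3 κ 𝔭 ∅ γ n₀ →
          Finite {x : AcSelmer.XAc (W.baseChange K) 3 κ 𝔭 ∅ γ //
            (PowerSeries.X : IwasawaAlgebra 3) • x = 0} →
          (n₀ : ℤ) + padicValNat 3 (Nat.card {x : AcSelmer.XAc (W.baseChange K) 3 κ 𝔭 ∅ γ //
              (PowerSeries.X : IwasawaAlgebra 3) • x = 0}) =
            padicValNat 3 (Nat.card ↥(strictSelmerPInfty W 3)) +
              padicValNat 3 (Nat.card ↥(strictSelmerPInfty W' 3)) +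
              padicValNat 3 (controlDefectAtThree W K 𝔭 κ T₀)

/-- **(R-EU)₃ᵛ TYPED (the V line's ONE residual; NOT in print; nothing asserted): the DEFECT-CORRECTED
elliptic-unit index formula at the ramified prime `3`, analytic rank one, regimes N ∪ V** — gen 1's
(R-EU)₃ with the away binder weakened to «(Av)₃ off `T₀`» and the right side corrected by the
displayed defect: whenever `X` has the shape `ord₃ f(0) = n₀` with `X[T]` finite,
  `n₀ + log₃ #X[T] = n + n' + ord₃ #Ш_an(W) + ord₃ #Ш_an(W') + log₃ d(T₀)`.
With `T₀ = ∅` (regime N) this is (R-EU)₃ (`d(∅) = 1`); on regime V it is lit DOSSIER §32 (e5)'s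
`c = n + n' + ord₃(qq') + (#S_V − t)` in Selmer form (Perrin-Riou's leading-term law for the CM zeta
element at `3` would give the left side; no explicit reciprocity law at a ramified prime is in print,
BKNO §1.4 «report elsewhere», their road `p ≥ 5`). Given (R-ctrl)₃ᵛ♯ (a theorem) it is, on these
members, exactly what is needed for `BSDp W 3` (§3 and the sequel). LABEL: CONSTRUCTION / OPEN; nothing asserted.
[cite: PerrinRiou1993AIF, §3.3.4–3.3.5 (pp. 976–977: the conjectural leading-term formula)]
[cite: BurungaleKobayashiNakamuraOta2026, §1.4 and Thm. 7.2 (arXiv:2608.06879 pp. 8, 41; `p ≥ 5` there) (claim; preprint; shape only)]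
[cite: GrossZagier1986, Thm. I.(7.3) (rationality of #Ш_an)] [cite: GreenbergLNM1716, §4 Prop. 4.13 (the defect term)] -/
@[conjecture] def RamifiedCMEllipticUnitIndexAtThreeV : Prop :=
  ∀ (K : Type) [Field K] [NumberField K] (𝔭 : HeightOneSpectrum (𝓞 K))
    (W' : WeierstrassCurve ℚ) [W'.IsElliptic] [W'.IsGloballyMinimal] (C : VariableChange ℚ),
    IsFrameThree W K 𝔭 W' C → W.analyticRank = 1 →
    ∀ (κ : ZpExtension K 3), κ.IsAnticyclotomic →
      ∀ (γ : absoluteGaloisGroup K) [Fact (κ.IsTopGenerator γ)]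
        (P : W.toAffine.Point) (n : ℕ) (P' : W'.toAffine.Point) (n' : ℕ),
        ¬ IsOfFinAddOrder P →
        (∀ R : W.toAffine.Point, ∃ (k : ℤ) (T : W.toAffine.Point), IsOfFinAddOrder T ∧ R = k • P + T) →
        (∀ Q : (W.baseChange ℚ_[3]).toAffine.Point, (3 : ℕ) • Q = 0 → Q = 0) →
        (∃ Q : (W.baseChange ℚ_[3]).toAffine.Point, (3 : ℕ) ^ n • Q = W.toPadicPoint 3 P) →
        (∀ Q : (W.baseChange ℚ_[3]).toAffine.Point, (3 : ℕ) ^ (n + 1) • Q ≠ W.toPadicPoint 3 P) →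
        ¬ IsOfFinAddOrder P' →
        (∀ R : W'.toAffine.Point, ∃ (k : ℤ) (T : W'.toAffine.Point),
          IsOfFinAddOrder T ∧ R = k • P' + T) →
        (∀ Q : (W'.baseChange ℚ_[3]).toAffine.Point, (3 : ℕ) • Q = 0 → Q = 0) →
        (∃ Q : (W'.baseChange ℚ_[3]).toAffine.Point, (3 : ℕ) ^ n' • Q = W'.toPadicPoint 3 P') →
        (∀ Q : (W'.baseChange ℚ_[3]).toAffine.Point, (3 : ℕ) ^ (n' + 1) • Q ≠ W'.toPadicPoint 3 P') →
        ∀ (T₀ : Finset (HeightOneSpectrum (𝓞 K))), (∀ v ∈ T₀, ((3 : ℕ) : 𝓞 K) ∉ v.asIdeal) →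
        (∀ v : HeightOneSpectrum (𝓞 K), v ∉ T₀ → ((3 : ℕ) : 𝓞 K) ∉ v.asIdeal →
          v.asIdeal.ramificationIdx (𝓞 ℚ) = 1 → v.asIdeal.inertiaDeg (𝓞 ℚ) = 1 →
          (W.baseChange K).HasGoodReductionAt v ∨
            ∀ R : ((W.baseChange K).baseChange (v.adicCompletion K)).toAffine.Point,
              (3 : ℕ) • R = 0 → R = 0) →
        ∀ (q q' : ℚ), shaAn W = (q : ℂ) → shaAn W' = (q' : ℂ) →
        ∀ (n₀ : ℕ), AcSelmer.XAc.HasCharValuationAt (W.baseChange K) 3 κ 𝔭 ∅ γ n₀ →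
          Finite {x : AcSelmer.XAc (W.baseChange K) 3 κ 𝔭 ∅ γ //
            (PowerSeries.X : IwasawaAlgebra 3) • x = 0} →
          (n₀ : ℤ) + padicValNat 3 (Nat.card {x : AcSelmer.XAc (W.baseChange K) 3 κ 𝔭 ∅ γ //
              (PowerSeries.X : IwasawaAlgebra 3) • x = 0}) =
            (n : ℤ) + n' + padicValRat 3 q + padicValRat 3 q' +
              padicValNat 3 (controlDefectAtThree W K 𝔭 κ T₀)

/-! ## §3 PROVED consumer: the three inputs at a `3`-frame on regimes N ∪ V give `BSD(W, 3)` -/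

section Consumer

variable {W}
variable {K : Type} [Field K] [NumberField K] {𝔭 : HeightOneSpectrum (𝓞 K)}
  {W' : WeierstrassCurve ℚ} [W'.IsElliptic] [W'.IsGloballyMinimal] {C : VariableChange ℚ}
  {κ : ZpExtension K 3} {P : W.toAffine.Point} {n : ℕ} {P' : W'.toAffine.Point} {n' : ℕ}

/-- **(R-tors)₃ᵛ ∧ (R-ctrl)₃ᵛ♯ ∧ (R-EU)₃ᵛ ⟹ `BSD(W, 3)`** at a `3`-framed pair `(W, W')` of analytic
rank one on regimes N ∪ V: frame, anticyclotomic `κ` with generator `γ`, generators `P`, `P'` with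
their `3`-divisibility levels, (A𝔭)₃ (`htors`, `htors'`), a finite `T₀` of places `v ∤ 3` with (Av)₃
off `T₀` (`hT₀`, `hv`), and the named facts Cassels (`hCassels`), Gross–Zagier I.(7.3) (`hGZ`), GZK
(`hGZK`), modularity (`hmod`). PROOF = gen 1's `bsdp_three_of_halves` verbatim: the defect `log₃ d(T₀)`
sits on the right of (R-ctrl)₃ᵛ♯ and of (R-EU)₃ᵛ and cancels; the DISCHARGED index theorem
(`StrictSha.strictSelmerIndexAt_holds`) and Cassels along `W ∼ W'` finish. CONDITIONAL on the three
typed inputs; nothing booked. [cite: Cassels1965ArithmeticVIII] [cite: MilneADT2006, Thm. I.7.3]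
[cite: GrossZagier1986, Thm. I.(7.3)] [cite: Miller2011LMS, §1 and Def. 1.1] -/
theorem bsdp_three_of_halvesV (hmod : hasEntireLFunction_rat) (hGZ : GrossZagier1986_thm_I_7_3)
    (hGZK : rank_eq_analyticRank_of_analyticRank_le_one) (hCassels : bsdRHS_eq_of_isIsogenous)
    (h1 : RamifiedCMStrictTorsionAtThreeV W) (h2 : RamifiedCMDefectControlAtThree W)
    (h3 : RamifiedCMEllipticUnitIndexAtThreeV W)
    (hF : IsFrameThree W K 𝔭 W' C) (hr : W.analyticRank = 1)
    (hκ : κ.IsAnticyclotomic) (γ : absoluteGaloisGroup K) [Fact (κ.IsTopGenerator γ)]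
    (hP : ¬ IsOfFinAddOrder P)
    (hgen : ∀ R : W.toAffine.Point, ∃ (k : ℤ) (T : W.toAffine.Point),
      IsOfFinAddOrder T ∧ R = k • P + T)
    (htors : ∀ Q : (W.baseChange ℚ_[3]).toAffine.Point, (3 : ℕ) • Q = 0 → Q = 0)
    (hdiv : ∃ Q : (W.baseChange ℚ_[3]).toAffine.Point, (3 : ℕ) ^ n • Q = W.toPadicPoint 3 P)
    (hndiv : ∀ Q : (W.baseChange ℚ_[3]).toAffine.Point, (3 : ℕ) ^ (n + 1) • Q ≠ W.toPadicPoint 3 P)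
    (hP' : ¬ IsOfFinAddOrder P')
    (hgen' : ∀ R : W'.toAffine.Point, ∃ (k : ℤ) (T : W'.toAffine.Point),
      IsOfFinAddOrder T ∧ R = k • P' + T)
    (htors' : ∀ Q : (W'.baseChange ℚ_[3]).toAffine.Point, (3 : ℕ) • Q = 0 → Q = 0)
    (hdiv' : ∃ Q : (W'.baseChange ℚ_[3]).toAffine.Point, (3 : ℕ) ^ n' • Q = W'.toPadicPoint 3 P')
    (hndiv' : ∀ Q : (W'.baseChange ℚ_[3]).toAffine.Point,
      (3 : ℕ) ^ (n' + 1) • Q ≠ W'.toPadicPoint 3 P')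
    (T₀ : Finset (HeightOneSpectrum (𝓞 K))) (hT₀ : ∀ v ∈ T₀, ((3 : ℕ) : 𝓞 K) ∉ v.asIdeal)
    (hv : ∀ v : HeightOneSpectrum (𝓞 K), v ∉ T₀ → ((3 : ℕ) : 𝓞 K) ∉ v.asIdeal →
      v.asIdeal.ramificationIdx (𝓞 ℚ) = 1 → v.asIdeal.inertiaDeg (𝓞 ℚ) = 1 →
      (W.baseChange K).HasGoodReductionAt v ∨
        ∀ R : ((W.baseChange K).baseChange (v.adicCompletion K)).toAffine.Point,
          (3 : ℕ) • R = 0 → R = 0) :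
    BSDp W 3 := by
  have hiso : IsIsogenous W W' := isIsogenous_of_isFrameThree hF
  -- ranks and finiteness of `Ш` for `W` and for the isogenous `W'` (GZK)
  obtain ⟨hrank, hfin⟩ := hGZK W hr.le
  haveI : Finite W.sha := hfin
  have hr' : W'.analyticRank = 1 := by rw [← analyticRank_eq_of_isIsogenous' hiso, hr]
  obtain ⟨-, hfin'⟩ := hGZK W' hr'.le
  haveI : Finite W'.sha := hfin'
  -- `#Ш_an ∈ ℚ^×` for both
  obtain ⟨q, hq⟩ := Disegni2020.exists_rat_shaAn_eq_of_analyticRank_eq_one hGZ hGZK W hr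
  obtain ⟨q', hq'⟩ := Disegni2020.exists_rat_shaAn_eq_of_analyticRank_eq_one hGZ hGZK W' hr'
  have hq0 : q ≠ 0 := by
    rintro rfl
    exact AdditivePotMult.shaAn_ne_zero W hmod (by rw [hq, Rat.cast_zero])
  have hq0' : q' ≠ 0 := by
    rintro rfl
    exact AdditivePotMult.shaAn_ne_zero W' hmod (by rw [hq', Rat.cast_zero])
  -- the three inputs
  obtain ⟨⟨n₀, hchar⟩, hfinT⟩ := h1 K 𝔭 W' C hF hr κ hκ γ htors htors' T₀ hT₀ hv
  have hctrl := h2 K 𝔭 W' C hF hr κ hκ γ P n P' n' hP hgen htors hdiv hndiv hP' hgen' htors' hdiv'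
    hndiv' T₀ hT₀ hv n₀ hchar hfinT
  have heu := h3 K 𝔭 W' C hF hr κ hκ γ P n P' n' hP hgen htors hdiv hndiv hP' hgen' htors' hdiv'
    hndiv' T₀ hT₀ hv q q' hq hq' n₀ hchar hfinT
  -- the DISCHARGED index theorem, for `W` and for `W'`
  haveI : Finite (AddCommGroup.primaryComponent W.sha 3) := inferInstance
  haveI : Finite (AddCommGroup.primaryComponent W'.sha 3) := inferInstance
  have hI := (StrictSha.strictSelmerIndexAt_holds W 3).padicValNat_card_eq hP hgen htors hdiv hndiv
  have hI' := (StrictSha.strictSelmerIndexAt_holds W' 3).padicValNat_card_eq hP' hgen' htors' hdiv'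
    hndiv'
  -- sum identity: `ord₃ #Ш(W)(3) + ord₃ #Ш(W')(3) = ord₃ q + ord₃ q'` (the defect cancels)
  have hsum : (padicValNat 3 (Nat.card (AddCommGroup.primaryComponent W.sha 3)) : ℤ) +
      padicValNat 3 (Nat.card (AddCommGroup.primaryComponent W'.sha 3)) =
      padicValRat 3 q + padicValRat 3 q' := by
    rw [hI, hI', Nat.cast_add, Nat.cast_add] at hctrl
    linarith
  -- Cassels along `W ∼ W'`: `#Ш_an(W) · #Ш(W') = #Ш_an(W') · #Ш(W)`
  obtain ⟨-, hRHS⟩ := hCassels W W' hiso hfin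
  have hlead_eq : W.leadingLCoeff = W'.leadingLCoeff := leadingLCoeff_eq_of_isIsogenous' hiso
  have h1W := Wuthrich2014.shaAn_mul_bsdRHS W
  have h1W' := Wuthrich2014.shaAn_mul_bsdRHS W'
  have hshaQ : (W.shaOrder : ℚ) ≠ 0 := by exact_mod_cast (W.shaOrder_pos hfin).ne'
  have hshaQ' : (W'.shaOrder : ℚ) ≠ 0 := by exact_mod_cast (W'.shaOrder_pos hfin').ne'
  have hRHS0 : (W.bsdRHS : ℂ) ≠ 0 := by exact_mod_cast W.bsdRHS_ne_zero hfin
  have hkey : (q : ℂ) * (W'.shaOrder : ℂ) = (q' : ℂ) * (W.shaOrder : ℂ) := by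
    rw [hq] at h1W
    rw [hq', hRHS, ← hlead_eq] at h1W'
    have h3 : ((q : ℂ) * (W'.shaOrder : ℂ)) * (W.bsdRHS : ℂ) =
        ((q' : ℂ) * (W.shaOrder : ℂ)) * (W.bsdRHS : ℂ) := by
      calc ((q : ℂ) * (W'.shaOrder : ℂ)) * (W.bsdRHS : ℂ)
          = ((q : ℂ) * (W.bsdRHS : ℂ)) * (W'.shaOrder : ℂ) := by ring
        _ = (W.leadingLCoeff * (W.shaOrder : ℂ)) * (W'.shaOrder : ℂ) := by rw [h1W]
        _ = (W.leadingLCoeff * (W'.shaOrder : ℂ)) * (W.shaOrder : ℂ) := by ring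
        _ = ((q' : ℂ) * (W.bsdRHS : ℂ)) * (W.shaOrder : ℂ) := by rw [h1W']
        _ = ((q' : ℂ) * (W.shaOrder : ℂ)) * (W.bsdRHS : ℂ) := by ring
    exact mul_right_cancel₀ hRHS0 h3
  have hkeyQ : q * (W'.shaOrder : ℚ) = q' * (W.shaOrder : ℚ) := by exact_mod_cast hkey
  have hval : padicValRat 3 q + (padicValNat 3 W'.shaOrder : ℤ) =
      padicValRat 3 q' + (padicValNat 3 W.shaOrder : ℤ) := by
    have h := congrArg (padicValRat 3) hkeyQ
    rwa [padicValRat.mul hq0 hshaQ', padicValRat.mul hq0' hshaQ, padicValRat.of_nat,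
      padicValRat.of_nat] at h
  refine ⟨hrank, inferInstance, q, hq, ?_⟩
  rw [padicValNat_card_addPrimaryComponent, padicValNat_card_addPrimaryComponent] at hsum
  rw [padicValNat_card_addPrimaryComponent]
  have e1 : W.shaOrder = Nat.card W.sha := rfl
  have e2 : W'.shaOrder = Nat.card W'.sha := rfl
  rw [e1, e2] at hval
  linarith

end Consumer

end Summit.BirchSwinnertonDyer.Rank1Residual.X12.O11

end
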